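/-
Origin: expansion seat `prover-pub-hodgecm-mc-binder-2-g7-0`, handover #5 17:50Z md5 c361099bf829 (229 l.; imports discharge-3 #6 `ArchDatumBlockCM` ONLY; = row #6's block frame at an ARBITRARY real place `v` with all four block types relabelled: abbrevs `cmBlockSplitAt cmBlockRelabelAt cmBlockPhaseHomAt cmBlockRepAt cmBlockSectionAt`, thms `isArchWeilDatum_cmBlockAt continuous_cmBlockRepAt continuous_cmBlockSectionAt coe_cmBlockPhaseHomAt_cmBlockSectionAt`; one `set_option maxHeartbeats 1600000 in` (same as row #6's `hs`)) (`HOME/mc/pub-hodgecm-mc-binder-2/g7/pkg/HodgeCM/Model/HypCensus/ArchDatumBlockAt.lean`, md5 c361099b, 229 lines);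
landed by the gen-12 packager (p-g12) in gate run 36 as `HodgeCM/Model/HypCensus/ArchDatumBlockAt.lean` (verbatim).
-/
/-
Origin: speedrun cell pub-hodgecm, MODEL-CONSTRUCTION sub-cell, lineage mc-binder-2 (rows A12/A34 of the binder ledger:
`hyp12` / `hyp34`), seat prover-pub-hodgecm-mc-binder-2-g7-0 (gen 7), 2026-08-19.  Target in PKG:
`HodgeCM/Model/HypCensus/ArchDatumBlockAt.lean` (NEW additive leaf; imports mc-discharge-3's row #6 `ArchDatumBlockCM` only).
KERNEL only: 0 records / named facts / proof holes; the definitions are abbreviations of composites of landed terms.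
-/
import Summits.HodgeConjecture.HodgeCM.Model.HypCensus.ArchDatumBlockCM

/-!
# Census kit (rows A12/A34), junction (J-arch)→(J-plc) at an ARBITRARY real place: the block frame of the CM pin at `v`

mc-discharge-3's `ArchDatumBlockCM` (row #6) reads the (J-arch) datum of the CM pin in the block frame of the ONE place
`cmPlace ι₁` under the distinguished embedding, with the `V`-side block types relabelled to `Fin 2`, `Unit` (signature
`(2,1)`), for the consumer BRICK-4 § 2 (`Model/ArchKTypeJunction`: boosts on the `V` = ball side).  The census of rows
A12/A34 (`HypSmoothSide.smooth`, PerL v5 Lemma 4.1(c)) differentiates along the hyperbolic one-parameter subgroup of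
`U(W_b) ≅ U(1,1)` at EVERY real place `b` of type `Σ₁₂` (there `V_b` is definite).  This leaf is the same assembly as
row #6, verbatim in its proofs, but

* at an ARBITRARY real place `v` of `L⁺` (row #6: `v := cmPlace ι₁`), and
* with ALL FOUR block types relabelled along bijections `eP : PosIdx (x_V v) ≃ P'`, `eQ : NegIdx (x_V v) ≃ Q'`,
  `eR : PosIdx (x_W v) ≃ R'`, `eS : NegIdx (x_W v) ≃ S'` (row #6: `eR = eS = Equiv.refl`).

Contents (all names `…At`; the frame data `cmXV cmXW cmEpsV cmEpsW cmDV cmDW cmCW cmArchPairPhaseHom cmBigFrame` are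
row #6's, imported, not restated):
* §1 `cmBlockSplitAt v`, `cmBlockRelabelAt v eP eQ eR eS`;
* §2 **`cmBlockPhaseHomAt`**, **`cmBlockRepAt`**, **`isArchWeilDatum_cmBlockAt`** (row #5 + `IsArchWeilDatum.reindex` twice),
  **`continuous_cmBlockRepAt`**;
* §3 **`cmBlockSectionAt : Ginf P' Q' R' S' →* arch J_V × arch J_W`** (T4 `archPairSection` at `v` ∘ T3 `Ginf.relabel⁻¹`),
  **`continuous_cmBlockSectionAt`**, **`coe_cmBlockPhaseHomAt_cmBlockSectionAt`**
  (`⇑(ι𝕎′ (s u)) = blockPhase ⇑(ι𝕎 P' Q' R' S' u) id`).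

These are exactly the five inputs `hW hc s hs_cont hs` of the tree's archimedean factorisation
`IsArchWeilDatum.exists_circle_twist_factorisation(_clm)` at the place `v`; the census file `SmoothBlock` consumes them
with `(R', S') = (Unit, Unit)` at a `Σ₁₂` place.  Nothing here is a claim of PerL/QW8.  [Folland1989, Prop. (1.43), §4.2;
Weil1964, Chap. I n° 12, Chap. III n° 37–39; KonnoKonno2007, §3.1] is the provenance of the tree theorems used.
Style lint (L-notation): no `local notation`.
-/

set_option autoImplicit false

noncomputable section

open NumberField NumberField.InfinitePlace IsDedekindDomain MeasureTheory
open scoped Matrix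
open scoped Kronecker Classical TensorProduct ComplexConjugate
open Literature.NumberTheory.Automorphic Literature.NumberTheory.Automorphic.UnitaryGroup Literature.NumberTheory.Weil1964
open Literature.RepresentationTheory.HeisenbergGroup (polar Heisenberg symplecticGroup ofSymplectic)
open Literature.RepresentationTheory.KonnoKonno2007 Literature.RepresentationTheory.KonnoKonno2007.RealDualPair
open Literature.NumberTheory.GelbartRogawski1991 Literature.NumberTheory.GelbartRogawski1991.UnitaryDualPair
open Literature.Analysis.SegalBargmann

namespace HodgeCM.Model.HypCensus

section CMPinBlockAt

variable (L : Type) [Field L] [NumberField L] [IsCMField L] {N M n : ℕ} (e : Fin N × Fin M ≃ Fin n)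
variable (dV : Fin N → L) (hdV : ∀ i, IsCMField.complexConj L (dV i) = dV i) (hdV0 : ∀ i, dV i ≠ 0)
variable (dW : Fin M → L) (hdW : ∀ i, IsCMField.complexConj L (dW i) = dW i) (hdW0 : ∀ i, dW i ≠ 0)
variable (hGR : (cmSplittingDatum L e dV hdV hdV0 dW hdW hdW0).CompatibleSplitting) (ι₁ : L →+* ℂ)
variable (v : {v : InfinitePlace ↥(maximalRealSubfield L) // v.IsReal})

/-! ## §1 The split and the relabelling at the place `v` -/

/-- the split of the place frame at the real place `v`, the slice read in Konno–Konno's block index. -/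
abbrev cmBlockSplitAt :
    DPIdx (PosIdx (cmXV L dV hdV ι₁ v)) (NegIdx (cmXV L dV hdV ι₁ v)) (PosIdx (cmXW L dV dW hdW ι₁ v))
        (NegIdx (cmXW L dV dW hdW ι₁ v)) ⊕
        (Fin n × {w : {w : InfinitePlace ↥(maximalRealSubfield L) // w.IsReal} // w ≠ v}) ≃
      Fin n × {w : InfinitePlace ↥(maximalRealSubfield L) // w.IsReal} :=
  placeSplitEquiv
    (pairFrame (PosIdx (cmXV L dV hdV ι₁ v)) (NegIdx (cmXV L dV hdV ι₁ v)) (PosIdx (cmXW L dV dW hdW ι₁ v))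
      (NegIdx (cmXW L dV dW hdW ι₁ v)) e (cmEpsV L dV hdV ι₁ v) (cmEpsW L dV dW hdW ι₁ v))
    v

variable {P' Q' R' S' : Type} [Fintype P'] [DecidableEq P'] [Fintype Q'] [DecidableEq Q'] [Fintype R'] [DecidableEq R']
  [Fintype S'] [DecidableEq S']
variable (eP : PosIdx (cmXV L dV hdV ι₁ v) ≃ P') (eQ : NegIdx (cmXV L dV hdV ι₁ v) ≃ Q')
  (eR : PosIdx (cmXW L dV dW hdW ι₁ v) ≃ R') (eS : NegIdx (cmXW L dV dW hdW ι₁ v) ≃ S')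

/-- the relabelling of all four block types at `v` to the literal types `P' Q' R' S'` of the consumer's frame. -/
abbrev cmBlockRelabelAt :
    (DPIdx P' Q' R' S' ⊕ (Fin n × {w : {w : InfinitePlace ↥(maximalRealSubfield L) // w.IsReal} // w ≠ v})) ≃
      (DPIdx (PosIdx (cmXV L dV hdV ι₁ v)) (NegIdx (cmXV L dV hdV ι₁ v)) (PosIdx (cmXW L dV dW hdW ι₁ v))
          (NegIdx (cmXW L dV dW hdW ι₁ v)) ⊕
        (Fin n × {w : {w : InfinitePlace ↥(maximalRealSubfield L) // w.IsReal} // w ≠ v})) :=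
  Equiv.sumCongr
    (dpIdxCongr (PosIdx (cmXV L dV hdV ι₁ v)) (NegIdx (cmXV L dV hdV ι₁ v)) (PosIdx (cmXW L dV dW hdW ι₁ v))
      (NegIdx (cmXW L dV dW hdW ι₁ v)) P' Q' R' S' eP eQ eR eS).symm
    (Equiv.refl _)

/-! ## §2 The big datum of the pin in the block frame at `v`: `hW` and `hc` -/

/-- **`ι𝕎′` at `v`**: the (J-arch) phase homomorphism read in the block frame of the place `v`. -/
abbrev cmBlockPhaseHomAt :
    UnitaryGroup.arch (↥(maximalRealSubfield L)) L (IsCMField.complexConj L) N (Matrix.diagonal dV) ×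
        UnitaryGroup.arch (↥(maximalRealSubfield L)) L (IsCMField.complexConj L) M (Matrix.diagonal dW) →*
      symplecticGroup (polar (dotPairing
        (DPIdx P' Q' R' S' ⊕ (Fin n × {w : {w : InfinitePlace ↥(maximalRealSubfield L) // w.IsReal} // w ≠ v})))) :=
  (reindexSp (cmBlockRelabelAt L dV hdV dW hdW ι₁ v eP eQ eR eS)).comp
    ((reindexSp (cmBlockSplitAt L e dV hdV dW hdW ι₁ v)).comp (cmArchPairPhaseHom L e dV hdV hdV0 dW hdW hdW0 ι₁))

/-- **`ω′` at `v`**: `cmArchWeilRep` in the scaled Folland frame, split at `v`, block types relabelled. -/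
abbrev cmBlockRepAt :
    Representation ℂ
      (UnitaryGroup.arch (↥(maximalRealSubfield L)) L (IsCMField.complexConj L) N (Matrix.diagonal dV) ×
        UnitaryGroup.arch (↥(maximalRealSubfield L)) L (IsCMField.complexConj L) M (Matrix.diagonal dW))
      (SchwartzMap
        (DPIdx P' Q' R' S' ⊕ (Fin n × {w : {w : InfinitePlace ↥(maximalRealSubfield L) // w.IsReal} // w ≠ v}) → ℝ) ℂ) :=
  repTransport (reindexCLE (cmBlockRelabelAt L dV hdV dW hdW ι₁ v eP eQ eR eS))
    (repTransport (reindexCLE (cmBlockSplitAt L e dV hdV dW hdW ι₁ v))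
      (repTransport (cmBigFrame L e dV hdV hdV0 dW hdW hdW0 ι₁) (cmArchWeilRep L e dV hdV hdV0 dW hdW hdW0 hGR)))

omit [DecidableEq P'] [DecidableEq Q'] [DecidableEq R'] [DecidableEq S'] in
/-- **`hW` at `v`** — the big archimedean datum of the CM pin in the block frame of `v`, from the sign facts of the
consumer's form (hypotheses of `hasThetaMajorants_cmPairSplitting_of_signs` VERBATIM).
[Folland1989, §4.2, Prop. (1.43); Weil1964, Chap. I n° 12, Chap. III n° 37–39] -/
theorem isArchWeilDatum_cmBlockAt
    (h₁V : ∃ i₀ : Fin N, (∀ i, i ≠ i₀ → 0 < (ι₁ (dV i)).re) ∨ ∀ i, i ≠ i₀ → (ι₁ (dV i)).re < 0)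
    (h₁W : (∀ j, 0 < (ι₁ (dW j)).re) ∨ ∀ j, (ι₁ (dW j)).re < 0)
    (hV : ∀ τ : L →+* ℂ, InfinitePlace.mk τ ≠ InfinitePlace.mk ι₁ →
      (∀ i, 0 < (τ (dV i)).re) ∨ ∀ i, (τ (dV i)).re < 0)
    (hW : ∀ τ : L →+* ℂ, InfinitePlace.mk τ ≠ InfinitePlace.mk ι₁ →
      (∃ j₀ : Fin M, ∀ j, j ≠ j₀ → 0 < (τ (dW j)).re) ∨ ∀ j, (τ (dW j)).re < 0) :
    IsArchWeilDatum (cmBlockPhaseHomAt L e dV hdV hdV0 dW hdW hdW0 ι₁ v eP eQ eR eS)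
      (cmBlockRepAt L e dV hdV hdV0 dW hdW hdW0 hGR ι₁ v eP eQ eR eS) :=
  ((isArchWeilDatum_repTransport_cmArchWeilRep_of_signs L e dV hdV hdV0 dW hdW hdW0 hGR ι₁ h₁V h₁W hV hW).reindex
      (cmBlockSplitAt L e dV hdV dW hdW ι₁ v)).reindex
    (cmBlockRelabelAt L dV hdV dW hdW ι₁ v eP eQ eR eS)

omit [DecidableEq P'] [DecidableEq Q'] [DecidableEq R'] [DecidableEq S'] in
/-- **`hc` at `v`**: every operator of the block-frame representation is continuous. -/
theorem continuous_cmBlockRepAt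
    (g : UnitaryGroup.arch (↥(maximalRealSubfield L)) L (IsCMField.complexConj L) N (Matrix.diagonal dV) ×
      UnitaryGroup.arch (↥(maximalRealSubfield L)) L (IsCMField.complexConj L) M (Matrix.diagonal dW)) :
    Continuous (cmBlockRepAt L e dV hdV hdV0 dW hdW hdW0 hGR ι₁ v eP eQ eR eS g) :=
  continuous_repTransport_reindexCLE _
    (fun g => continuous_repTransport_reindexCLE _
      (fun g => continuous_repTransport_archWeilRep (↥(maximalRealSubfield L)) L (IsCMField.complexConj L) N M
        (Matrix.diagonal dV) (Matrix.diagonal dW) (complexConj_imagUnit L) (imagUnit_ne_zero L) (imagUnit_mul_self L)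
        (realDiagonal_isSymm L dV hdV) (realDiagonal_isSymm L dW hdW)
        (isUnit_det_realDiagonal L dV hdV hdV0) (isUnit_det_realDiagonal L dW hdW hdW0)
        (realDiagonal_map L dV hdV).symm (realDiagonal_map L dW hdW).symm e
        (cmSplittingOf L e dV hdV hdV0 dW hdW hdW0 hGR) (proj_cmSplittingOf L e dV hdV hdV0 dW hdW hdW0 hGR)
        (cmBigFrame L e dV hdV hdV0 dW hdW hdW0 ι₁) g) g) g

/-! ## §3 The block section at `v`: `s`, `hs_cont`, `hs` -/

/-- **`s` at `v`**: the section `U(P',Q') × U(R',S') →* arch J_V × arch J_W` at the place `v` (T4's `archPairSection` at the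
canonical frames, precomposed with T3's four-fold relabelling). -/
abbrev cmBlockSectionAt :
    Ginf P' Q' R' S' →*
      UnitaryGroup.arch (↥(maximalRealSubfield L)) L (IsCMField.complexConj L) N (Matrix.diagonal dV) ×
        UnitaryGroup.arch (↥(maximalRealSubfield L)) L (IsCMField.complexConj L) M (Matrix.diagonal dW) :=
  (archPairSection L (IsCMField.complexConj L) N M (IsCMField.complexConj_ne_one L) (cmPlaceOver L) (cmPlaceOver_smul L)
      (cmPlaceOver_comap L) (cmRealVec L dV hdV) (cmRealVec L dW hdW) (realDiagonal_map L dV hdV).symm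
      (realDiagonal_map L dW hdW).symm (cmEpsV L dV hdV ι₁) (cmEpsW L dV dW hdW ι₁) (cmDV_ne_zero L dV hdV hdV0 ι₁)
      (cmDW_ne_zero L dV dW hdW hdW0 ι₁) (cmSignConv_ne_zero L dV ι₁) (cmCW_ne_zero L dV ι₁) (cm_htV L dV hdV hdV0 ι₁)
      (cm_htW L dV dW hdW hdW0 ι₁) (complexConj_smul_infinitePlace L) v).comp
    (Ginf.relabel (PosIdx (cmXV L dV hdV ι₁ v)) (NegIdx (cmXV L dV hdV ι₁ v)) (PosIdx (cmXW L dV dW hdW ι₁ v))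
        (NegIdx (cmXW L dV dW hdW ι₁ v)) P' Q' R' S' eP eQ eR eS).symm.toMulEquiv.toMonoidHom

/-- **`hs_cont` at `v`**: the block section is continuous. -/
theorem continuous_cmBlockSectionAt : Continuous (cmBlockSectionAt L dV hdV hdV0 dW hdW hdW0 ι₁ v eP eQ eR eS) :=
  (continuous_archPairSection L (IsCMField.complexConj L) N M (IsCMField.complexConj_ne_one L) (cmPlaceOver L)
      (cmPlaceOver_smul L) (cmPlaceOver_comap L) (cmRealVec L dV hdV) (cmRealVec L dW hdW) (realDiagonal_map L dV hdV).symm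
      (realDiagonal_map L dW hdW).symm (cmEpsV L dV hdV ι₁) (cmEpsW L dV dW hdW ι₁) (cmDV_ne_zero L dV hdV hdV0 ι₁)
      (cmDW_ne_zero L dV dW hdW hdW0 ι₁) (cmSignConv_ne_zero L dV ι₁) (cmCW_ne_zero L dV ι₁) (cm_htV L dV hdV hdV0 ι₁)
      (cm_htW L dV dW hdW hdW0 ι₁) (complexConj_smul_infinitePlace L) v).comp
    (Ginf.relabel (PosIdx (cmXV L dV hdV ι₁ v)) (NegIdx (cmXV L dV hdV ι₁ v)) (PosIdx (cmXW L dV dW hdW ι₁ v))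
        (NegIdx (cmXW L dV dW hdW ι₁ v)) P' Q' R' S' eP eQ eR eS).symm.continuous

set_option maxHeartbeats 1600000 in
/-- **`hs` at `v` — the block section acts, in the block frame, by the block of Konno–Konno's `ι𝕎 P' Q' R' S'` and the
identity.** [Weil1964, Chap. I n° 12; KonnoKonno2007, §3.1 (3.1); Folland1989, Prop. (1.43)] -/
theorem coe_cmBlockPhaseHomAt_cmBlockSectionAt (u : Ginf P' Q' R' S') :
    (⇑((cmBlockPhaseHomAt L e dV hdV hdV0 dW hdW hdW0 ι₁ v eP eQ eR eS
          (cmBlockSectionAt L dV hdV hdV0 dW hdW hdW0 ι₁ v eP eQ eR eS u)).1 :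
        ((DPIdx P' Q' R' S' ⊕ (Fin n × {w : {w : InfinitePlace ↥(maximalRealSubfield L) // w.IsReal} // w ≠ v}) → ℝ) ×
          (DPIdx P' Q' R' S' ⊕ (Fin n × {w : {w : InfinitePlace ↥(maximalRealSubfield L) // w.IsReal} // w ≠ v}) → ℝ)) ≃ₗ[ℝ]
        ((DPIdx P' Q' R' S' ⊕ (Fin n × {w : {w : InfinitePlace ↥(maximalRealSubfield L) // w.IsReal} // w ≠ v}) → ℝ) ×
          (DPIdx P' Q' R' S' ⊕ (Fin n × {w : {w : InfinitePlace ↥(maximalRealSubfield L) // w.IsReal} // w ≠ v}) → ℝ))) :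
        PhaseMap (DPIdx P' Q' R' S' ⊕ (Fin n × {w : {w : InfinitePlace ↥(maximalRealSubfield L) // w.IsReal} // w ≠ v}))) =
      blockPhase
        (⇑((ι𝕎 P' Q' R' S' u).1 :
          ((DPIdx P' Q' R' S' → ℝ) × (DPIdx P' Q' R' S' → ℝ)) ≃ₗ[ℝ] ((DPIdx P' Q' R' S' → ℝ) × (DPIdx P' Q' R' S' → ℝ))))
        id := by
  -- the canonical-frame pair element behind `u`
  have hu : Ginf.relabel (PosIdx (cmXV L dV hdV ι₁ v)) (NegIdx (cmXV L dV hdV ι₁ v)) (PosIdx (cmXW L dV dW hdW ι₁ v))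
      (NegIdx (cmXW L dV dW hdW ι₁ v)) P' Q' R' S' eP eQ eR eS
      ((Ginf.relabel (PosIdx (cmXV L dV hdV ι₁ v)) (NegIdx (cmXV L dV hdV ι₁ v)) (PosIdx (cmXW L dV dW hdW ι₁ v))
        (NegIdx (cmXW L dV dW hdW ι₁ v)) P' Q' R' S' eP eQ eR eS).symm.toMulEquiv.toMonoidHom u) = u :=
    ContinuousMulEquiv.apply_symm_apply _ u
  -- step 1 (T2 + T4): in the split frame the section acts by the block of `ι𝕎 … u₀` and the identity
  have h₁ := coe_reindexSp_piPhaseHom_comp_section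
    (fun w => pairFrame (PosIdx (cmXV L dV hdV ι₁ w)) (NegIdx (cmXV L dV hdV ι₁ w)) (PosIdx (cmXW L dV dW hdW ι₁ w))
      (NegIdx (cmXW L dV dW hdW ι₁ w)) e (cmEpsV L dV hdV ι₁ w) (cmEpsW L dV dW hdW ι₁ w))
    (fun w => ι𝕎 (PosIdx (cmXV L dV hdV ι₁ w)) (NegIdx (cmXV L dV hdV ι₁ w)) (PosIdx (cmXW L dV dW hdW ι₁ w))
      (NegIdx (cmXW L dV dW hdW ι₁ w))) v
    (MonoidHom.pi fun w =>
      (archPairPlace L (IsCMField.complexConj L) N M (IsCMField.complexConj_ne_one L) (cmPlaceOver L) (cmPlaceOver_smul L)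
          (cmPlaceOver_comap L) (cmRealVec L dV hdV) (cmRealVec L dW hdW) (realDiagonal_map L dV hdV).symm
          (realDiagonal_map L dW hdW).symm (cmEpsV L dV hdV ι₁) (cmEpsW L dV dW hdW ι₁) (cmDV_ne_zero L dV hdV hdV0 ι₁)
          (cmDW_ne_zero L dV dW hdW hdW0 ι₁) (cmSignConv_ne_zero L dV ι₁) (cmCW_ne_zero L dV ι₁) (cm_htV L dV hdV hdV0 ι₁)
          (cm_htW L dV dW hdW hdW0 ι₁) w).comp
        (archProdHom (↥(maximalRealSubfield L)) L (IsCMField.complexConj L) N M (Matrix.diagonal dV) (Matrix.diagonal dW)))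
    (archPairSection L (IsCMField.complexConj L) N M (IsCMField.complexConj_ne_one L) (cmPlaceOver L) (cmPlaceOver_smul L)
      (cmPlaceOver_comap L) (cmRealVec L dV hdV) (cmRealVec L dW hdW) (realDiagonal_map L dV hdV).symm
      (realDiagonal_map L dW hdW).symm (cmEpsV L dV hdV ι₁) (cmEpsW L dV dW hdW ι₁) (cmDV_ne_zero L dV hdV hdV0 ι₁)
      (cmDW_ne_zero L dV dW hdW hdW0 ι₁) (cmSignConv_ne_zero L dV ι₁) (cmCW_ne_zero L dV ι₁) (cm_htV L dV hdV hdV0 ι₁)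
      (cm_htW L dV dW hdW hdW0 ι₁) (complexConj_smul_infinitePlace L) v)
    (fun g => archPairPlace_archPairSection L (IsCMField.complexConj L) N M (IsCMField.complexConj_ne_one L) (cmPlaceOver L)
      (cmPlaceOver_smul L) (cmPlaceOver_comap L) (cmRealVec L dV hdV) (cmRealVec L dW hdW) (realDiagonal_map L dV hdV).symm
      (realDiagonal_map L dW hdW).symm (cmEpsV L dV hdV ι₁) (cmEpsW L dV dW hdW ι₁) (cmDV_ne_zero L dV hdV hdV0 ι₁)
      (cmDW_ne_zero L dV dW hdW hdW0 ι₁) (cmSignConv_ne_zero L dV ι₁) (cmCW_ne_zero L dV ι₁) (cm_htV L dV hdV hdV0 ι₁)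
      (cm_htW L dV dW hdW hdW0 ι₁) (complexConj_smul_infinitePlace L) v g)
    ((Ginf.relabel (PosIdx (cmXV L dV hdV ι₁ v)) (NegIdx (cmXV L dV hdV ι₁ v)) (PosIdx (cmXW L dV dW hdW ι₁ v))
        (NegIdx (cmXW L dV dW hdW ι₁ v)) P' Q' R' S' eP eQ eR eS).symm.toMulEquiv.toMonoidHom u)
  -- the same with the phase homomorphism spelled as `cmArchPairPhaseHom` and the compositions applied
  simp only [MonoidHom.comp_apply] at h₁
  -- step 2 (T3): relabel the four block types
  have h₂ := coe_reindexSp_sumCongr_of_eq_blockPhase eP eQ eR eS _ _ h₁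
  rw [hu] at h₂
  simpa only [MonoidHom.comp_apply, archPairPhaseHom] using h₂

end CMPinBlockAt

end HodgeCM.Model.HypCensus

end
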